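import Summits.FinalStateConjecture.FinalStateConjecture.Theorems.EIHFluxBalanceInertialRecessionStubChargeModelWindowLaw
import Summits.FinalStateConjecture.FinalStateConjecture.Theorems.EIHFluxBalanceInertialRecessionStubWindowCharges

/-!
# Route EIHFluxBalance — `InertialRecession`, line `sublinear-is-free-clean-window-charges`:
# the WINDOW LAW conjunct of `stub_chargeModel`, unconditionally in the pseudotensor bound

Helper file (`--supports stmt-FinalStateConjecture-10166`). `SublinearIsFree.ChargeModel.windowLaw`:
`(PTB) → ∀ X … O, (ANTECEDENT) → 0 < N → (SLAVED³) → (QS) → (WINDOW LAW)` — the first conjunct of the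
registered stub `stub_chargeModel` of the line, obtained by feeding the landed moving-sphere law
`SublinearIsFree.WindowCharges.stub_windowCharges : PTB → WCH′` into
`SublinearIsFree.ChargeModel.windowLaw_of_windowCharges : WCH′ → …`. (`kappa_slack_pos` is the carrier
sub-goal of this file: the window-law statement exceeds the stub-signature size limit.)
-/

set_option linter.dupNamespace false

noncomputable section

open scoped BigOperators Topology Manifold ContDiff ENNReal
open Filter Set TopologicalSpace Literature.Geometry.Lorentzian

namespace Summit.FinalStateConjecture.FinalStateConjecture.Theorems

namespace SublinearIsFree.ChargeModel

/-- The slack between the hole cone `κ²t` and the window cone `κt` is positive for `0 < κ < 1`.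
[folklore] -/
theorem kappa_slack_pos (κ : ℝ) (h0 : 0 < κ) (h1 : κ < 1) : 0 < κ - κ ^ 2 := by
  nlinarith

-- the algebraic and the operator-norm instance paths on `E4 →L[ℝ] E4 →L[ℝ] ℝ` unify slowly
set_option synthInstance.maxHeartbeats 400000 in
set_option maxHeartbeats 1600000 in
/-- **The WINDOW LAW conjunct of `stub_chargeModel`**: granted the Landau–Lifshitz pseudotensor bound
(PTB, stub `stub_pseudotensorBound` of the line), under the crux antecedent with `0 < N`, third-order
slaving and quasi-stationarity, the quasi-local Landau–Lifshitz momenta of the lab metric obey the window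
law `|P(t₂) − P(t₁)| ≤ C ∫_{t₁}^{t₂} R^{-3/2}` along 2-Lipschitz paths of `δ`-admissible windows above any
threshold `ρ → ∞` (`windowLaw_of_windowCharges` with `WindowCharges.stub_windowCharges`).
[cite: LandauLifshitz1975, §96 (96.16)] -/
theorem windowLaw :
    (∃ C : ℝ, 0 ≤ C ∧ ∀ (g : E4 → E4 →L[ℝ] E4 →L[ℝ] ℝ) (x : E4) (b : ℝ), ContDiffAt ℝ 2 g x → (∀ᶠ y in 𝓝 x, ∀ v w : E4, g y v w = g y w v) → ‖g x - Minkowski.bilin‖ ≤ 1 / 2 → (∀ v : E4, ‖fderiv ℝ g x v‖ ≤ b * ‖v‖) → ∀ μ ν : Fin 4, |LandauLifshitz.metricDet g x * LandauLifshitz.pseudotensor g x μ ν| ≤ C * b ^ 2) →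
    ∀ (X : Type) [TopologicalSpace X] [ChartedSpace E3 X] [IsManifold (𝓡 3) ((⊤ : ℕ∞) : WithTop ℕ∞) X] [T2Space X] [SecondCountableTopology X] [ConnectedSpace X], ∀ D ∈ admissibleVacuumData X, ∀ 𝒟 : VacuumCauchyDevelopment D, 𝒟.IsMaximal → ∀ (N : ℕ) (M a rin : Fin N → ℝ) (Λ : Fin N → ℝ → lorentzGroup) (ξ : Fin N → ℝ → E3) (γ κ τ₀ : ℝ) (U : Opens E4) (Φ : U → 𝒟.carrier) (O : Set 𝒟.carrier), ((∀ i, Kerr.IsSubextremal (M i) (a i) ∧ Kerr.rMinus (M i) (a i) < rin i ∧ rin i < Kerr.rPlus (M i) (a i)) ∧ (∀ i t, |((Λ i t : E4 ≃L[ℝ] E4) (E4.basisVector 0)) 0| ≤ γ) ∧ (∀ i, ContDiff ℝ ((⊤ : ℕ∞) : WithTop ℕ∞) (ξ i) ∧ ContDiff ℝ ((⊤ : ℕ∞) : WithTop ℕ∞) (fun t ↦ ((Λ i t : E4 ≃L[ℝ] E4) : E4 →L[ℝ] E4))) ∧ (∀ i j, i ≠ j → Tendsto (fun t ↦ ‖ξ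 i t - ξ j t‖) atTop atTop) ∧ (0 < κ ∧ κ < 1 ∧ ∀ i, ∀ᶠ t in atTop, ‖ξ i t‖ ≤ κ ^ 2 * t) ∧ ({x : E4 | τ₀ < x 0 ∧ ∀ i, rin i < Kerr.radius (a i) (poincareInv (Λ i (x 0)) (E4.ofTimeSpace (x 0) (ξ i (x 0))) x)} ⊆ (U : Set E4)) ∧ let B : ModelBackground := ⟨U, fun x ↦ Minkowski.bilin + ∑ i, (boostedKerrBilin (Λ i (x 0)) (E4.ofTimeSpace (x 0) (ξ i (x 0))) (M i) (a i) x - Minkowski.bilin), fun x ↦ x 0, E4.spatialNorm⟩; ContMDiff 𝓘(ℝ, E4) (𝓡 4) ((⊤ : ℕ∞) : WithTop ℕ∞) Φ ∧ Topology.IsOpenEmbedding ((B.lateRegion τ₀).restrict Φ) ∧ Φ '' {x : U | τ₀ < x.1 0 ∧ ∀ i, Kerr.rPlus (M i) (a i) < Kerr.radius (a i) (poincareInv (Λ i (x.1 0)) (E4.ofTimeSpace (x.1 0) (ξ i (x.1 0))) x.1)} ⊆ O ∧ Tendsto (fun t ↦ 𝒟.toSpacetime.deviationCk B Φ 3 t)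 atTop (𝓝 0) ∧ Tendsto (fun t : ℝ ↦ ⨆ x ∈ {x : U | x.1 0 = t ∧ E4.spatialNorm x.1 ≤ κ * t}, ⨆ (m : ℕ) (_ : m ≤ 3), ENNReal.ofReal (1 + √(√((⨅ i, ‖E4.spatial x.1 - ξ i t‖) ^ 7))) * ‖iteratedFDeriv ℝ m (𝒟.toSpacetime.deviationExtend B Φ) x.1‖ₑ) atTop (𝓝 0) ∧ O = Summit.FinalStateConjecture.exteriorOf 𝒟.toCauchyDevelopment (Φ '' {x : U | τ₀ < x.1 0 ∧ ∀ i, Kerr.rPlus (M i) (a i) < Kerr.radius (a i) (poincareInv (Λ i (x.1 0)) (E4.ofTimeSpace (x.1 0) (ξ i (x.1 0))) x.1)}) ∧ ∀ t₁ : ℝ, τ₀ < t₁ → O \ Φ '' {x : U | t₁ < x.1 0 ∧ ∀ i, Kerr.rPlus (M i) (a i) < Kerr.radius (a i) (poincareInv (Λ i (x.1 0)) (E4.ofTimeSpace (x.1 0) (ξ i (x.1 0))) x.1)} ⊆ 𝒟.metric.causalPast 𝒟.timeOrientation (Φ '' {x : U | x.1 0 = t₁ ∧ ∀ i, Kerr.rPlus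 (M i) (a i) < Kerr.radius (a i) (poincareInv (Λ i (x.1 0)) (E4.ofTimeSpace (x.1 0) (ξ i (x.1 0))) x.1)})) → 0 < N →
    (∀ i : Fin N, (∀ m : ℕ, 1 ≤ m → m ≤ 3 → Tendsto (fun t ↦ iteratedDeriv m (fun s ↦ (((Λ i s : lorentzGroup) : E4 ≃L[ℝ] E4) (E4.basisVector 0))) t) atTop (𝓝 0)) ∧ (∀ m : ℕ, m ≤ 2 → Tendsto (fun t ↦ iteratedDeriv m (fun s ↦ deriv (ξ i) s - (((((Λ i s : lorentzGroup) : E4 ≃L[ℝ] E4) (E4.basisVector 0)) 0)⁻¹ • E4.spatial (((Λ i s : lorentzGroup) : E4 ≃L[ℝ] E4) (E4.basisVector 0)))) t) atTop (𝓝 0)) ∧ (a i ≠ 0 → ∀ m : ℕ, 1 ≤ m → m ≤ 3 → Tendsto (fun t ↦ iteratedDeriv m (fun s ↦ (((Λ i s : lorentzGroup) : E4 ≃L[ℝ] E4) (E4.basisVector 3))) t) atTop (𝓝 0))) →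
    (∀ ρ : ℝ → ℝ, Tendsto ρ atTop atTop → Tendsto (fun t : ℝ ↦ ⨆ x ∈ {x : E4 | x 0 = t ∧ E4.spatialNorm x ≤ κ * t ∧ ρ t ≤ ⨅ i, ‖E4.spatial x - ξ i t‖}, ENNReal.ofReal (1 + √(√((⨅ i, ‖E4.spatial x - ξ i t‖) ^ 7))) * ‖fderiv ℝ (fun y : E4 ↦ Minkowski.bilin + ∑ i, (boostedKerrBilin (Λ i (y 0)) (E4.ofTimeSpace (y 0) (ξ i (y 0))) (M i) (a i) y - Minkowski.bilin)) x (E4.basisVector 0)‖ₑ) atTop (𝓝 0)) →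
    (∀ ρ : ℝ → ℝ, Tendsto ρ atTop atTop → ∀ δ : ℝ, 0 < δ → δ < 1 → ∃ (C T : ℝ), ∀ (t₁ t₂ : ℝ) (c : ℝ → E3) (R : ℝ → ℝ), T ≤ t₁ → t₁ ≤ t₂ → (∀ s ∈ Set.Icc t₁ t₂, ∀ s' ∈ Set.Icc t₁ t₂, ‖c s - c s'‖ ≤ 2 * |s - s'| ∧ |R s - R s'| ≤ 2 * |s - s'|) → (∀ s ∈ Set.Icc t₁ t₂, ρ s ≤ δ * R s ∧ ‖c s‖ + R s ≤ (κ + κ ^ 2) / 2 * s ∧ ∀ j, ‖ξ j s - c s‖ ≤ (1 - δ) * R s ∨ (1 + δ) * R s ≤ ‖ξ j s - c s‖) → ∀ μ : Fin 4, |(LandauLifshitz.quasiLocalMomentum (fun x : E4 ↦ (Minkowski.bilin + ∑ i, (boostedKerrBilin (Λ i (x 0)) (E4.ofTimeSpace (x 0) (ξ i (x 0))) (M i) (a i) x - Minkowski.bilin)) + 𝒟.toSpacetime.deviationExtend (⟨U, fun x ↦ Minkowski.bilin + ∑ i, (boostedKerrBilin (Λ i (x 0)) (E4.ofTimeSpace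 (x 0) (ξ i (x 0))) (M i) (a i) x - Minkowski.bilin), fun x ↦ x 0, E4.spatialNorm⟩ : ModelBackground) Φ x)) t₂ (c t₂) (R t₂) μ - (LandauLifshitz.quasiLocalMomentum (fun x : E4 ↦ (Minkowski.bilin + ∑ i, (boostedKerrBilin (Λ i (x 0)) (E4.ofTimeSpace (x 0) (ξ i (x 0))) (M i) (a i) x - Minkowski.bilin)) + 𝒟.toSpacetime.deviationExtend (⟨U, fun x ↦ Minkowski.bilin + ∑ i, (boostedKerrBilin (Λ i (x 0)) (E4.ofTimeSpace (x 0) (ξ i (x 0))) (M i) (a i) x - Minkowski.bilin), fun x ↦ x 0, E4.spatialNorm⟩ : ModelBackground) Φ x)) t₁ (c t₁) (R t₁) μ| ≤ C * ∫ s in t₁..t₂, (R s ^ (3 / 2 : ℝ))⁻¹) :=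
  fun hPTB ↦ windowLaw_of_windowCharges (WindowCharges.stub_windowCharges hPTB)

end SublinearIsFree.ChargeModel

/-- Registered sub-goal form (stub `stub_chargeModel_kappaSlack` of the crux item) of
`SublinearIsFree.ChargeModel.kappa_slack_pos` (carrier of this file, whose content `windowLaw` — the
WINDOW LAW conjunct of `stub_chargeModel` — has a statement exceeding the stub-signature size limit).
[folklore] -/
theorem stub_chargeModel_kappaSlack : ∀ (κ : ℝ), 0 < κ → κ < 1 → 0 < κ - κ ^ 2 :=
  SublinearIsFree.ChargeModel.kappa_slack_pos

end Summit.FinalStateConjecture.FinalStateConjecture.Theorems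

end
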